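import Literature.Probability.Divergences.FDivVariational
import Literature.Probability.Divergences.DonskerVaradhan
import HarnessLib

/-!
# Convexity of the Kullback–Leibler divergence in its first argument (finite mixtures)

Topic `Literature/Probability/Divergences`; companion of `FDivVariational.lean` (easy half of the
variational formula for Mathlib's `InformationTheory.klDiv`) and `DonskerVaradhan.lean` (hard half for
bounded measurable test functions). Combining the two halves gives, with no Radon–Nikodym bookkeeping:

* `integral_le_toReal_klDiv_add_log` — the Gibbs / Donsker–Varadhan inequality in LOG form for
  probability measures: `∫ ψ dμ ≤ KL(μ‖ν) + log ∫ e^ψ dν` for bounded measurable `ψ` when `KL(μ‖ν) < ∞`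
  (optimise the easy half over the additive constant);
* `klDiv_sum_smul_le` — **convexity of `μ ↦ KL(μ‖ν)` under finite mixtures**: for probability measures
  `μ_i`, `ν` and weights `w_i ∈ ℝ≥0∞` with `∑_{i∈s} w_i = 1`,
  `KL(∑ w_i μ_i ‖ ν) ≤ ∑ w_i KL(μ_i ‖ ν)` (average the log-form inequalities, then the hard half);
* `klDiv_cesaro_le` — the equal-weights case `KL(|s|⁻¹ ∑ μ_i ‖ ν) ≤ |s|⁻¹ ∑ KL(μ_i ‖ ν)` (Cesàro means,
  as used for space averages of states in the relative entropy method, Kipnis–Landim 1999 Ch. 6).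

Joint convexity in `(μ, ν)` and infinite mixtures are not treated here.
[cite: PolyanskiyWu2024, Thm. 5.1 (convexity of divergences), special case f = klFun, second argument fixed]
-/

noncomputable section

open _root_.MeasureTheory _root_.InformationTheory Set
open scoped ENNReal

namespace Literature.Probability.Divergences

variable {α : Type*} [MeasurableSpace α]

/-- **Gibbs / Donsker–Varadhan inequality, log form.** For probability measures `μ, ν` with
`KL(μ‖ν) < ∞` and a bounded measurable `ψ`: `∫ ψ dμ ≤ KL(μ‖ν) + log ∫ e^ψ dν` (the easy half
`∫ g dμ ≤ KL + ∫ (e^g - 1) dν` of `FDivVariational` at `g = ψ - log ∫ e^ψ dν`).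
[cite: KipnisLandim1999, Appendix 1 Thm. 8.3 (p. 338), lower-bound half] -/
theorem integral_le_toReal_klDiv_add_log {μ ν : Measure α} [IsProbabilityMeasure μ]
    [IsProbabilityMeasure ν] (hfin : klDiv μ ν ≠ ∞) {ψ : α → ℝ} (hψ : Measurable ψ) {C : ℝ}
    (hC : ∀ x, |ψ x| ≤ C) :
    ∫ x, ψ x ∂μ ≤ (klDiv μ ν).toReal + Real.log (∫ x, Real.exp (ψ x) ∂ν) := by
  set Z : ℝ := ∫ x, Real.exp (ψ x) ∂ν with hZdef
  have hexpi : Integrable (fun x => Real.exp (ψ x)) ν :=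
    Integrable.of_bound hψ.exp.aestronglyMeasurable (Real.exp C) (ae_of_all _ fun x => by
      rw [Real.norm_eq_abs, abs_of_pos (Real.exp_pos _)]
      exact Real.exp_le_exp.2 ((le_abs_self _).trans (hC x)))
  have hZ : 0 < Z := integral_exp_pos hexpi
  have hψi : Integrable ψ μ :=
    Integrable.of_bound hψ.aestronglyMeasurable C (ae_of_all _ fun x => by
      rw [Real.norm_eq_abs]; exact hC x)
  have hg : Integrable (fun x => ψ x - Real.log Z) μ := hψi.sub (integrable_const _)
  have hexp' : Integrable (fun x => Real.exp (ψ x - Real.log Z)) ν := by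
    simp_rw [Real.exp_sub, Real.exp_log hZ]
    exact hexpi.div_const Z
  have h := integral_le_toReal_klDiv_add_integral hfin hg hexp'
  have h1 : ∫ x, (ψ x - Real.log Z) ∂μ = ∫ x, ψ x ∂μ - Real.log Z := by
    rw [integral_sub hψi (integrable_const _), integral_const, smul_eq_mul, probReal_univ, one_mul]
  have h2 : ∫ x, (Real.exp (ψ x - Real.log Z) - 1) ∂ν = 0 := by
    simp_rw [Real.exp_sub, Real.exp_log hZ]
    rw [integral_sub (hexpi.div_const Z) (integrable_const _), integral_div, ← hZdef, div_self hZ.ne',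
      integral_const, smul_eq_mul, probReal_univ, one_mul, sub_self]
  rw [h1, h2, add_zero] at h
  linarith

/-- **Convexity of `μ ↦ KL(μ‖ν)` under finite mixtures.** For probability measures `μ_i` (`i ∈ s`),
`ν` and weights `w : ι → ℝ≥0∞` with `∑_{i∈s} w_i = 1`:
`KL(∑_{i∈s} w_i μ_i ‖ ν) ≤ ∑_{i∈s} w_i KL(μ_i ‖ ν)`. Proof: if some `μ_i` with `w_i ≠ 0` has infinite
divergence the bound is trivial; otherwise average the log-form inequalities
`∫ ψ dμ_i ≤ KL(μ_i‖ν) + log ∫ e^ψ dν` with the weights `w_i` and apply the Donsker–Varadhan upper bound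
to the mixture. [cite: PolyanskiyWu2024, Thm. 5.1 (convexity of f-divergences), f = klFun with the second argument fixed] -/
theorem klDiv_sum_smul_le {ι : Type*} (s : Finset ι) (w : ι → ℝ≥0∞) (hw : ∑ i ∈ s, w i = 1)
    (μ : ι → Measure α) [∀ i, IsProbabilityMeasure (μ i)] (ν : Measure α) [IsProbabilityMeasure ν] :
    klDiv (∑ i ∈ s, w i • μ i) ν ≤ ∑ i ∈ s, w i * klDiv (μ i) ν := by
  classical
  by_cases hdeg : ∃ i ∈ s, w i ≠ 0 ∧ klDiv (μ i) ν = ∞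
  · obtain ⟨i, hi, hwi, htop⟩ := hdeg
    calc klDiv (∑ i ∈ s, w i • μ i) ν ≤ ∞ := le_top
      _ = w i * klDiv (μ i) ν := by rw [htop, ENNReal.mul_top hwi]
      _ ≤ ∑ j ∈ s, w j * klDiv (μ j) ν :=
          Finset.single_le_sum (f := fun j => w j * klDiv (μ j) ν) (fun j _ => zero_le) hi
  push Not at hdeg
  -- the weights are finite
  have hw_ne_top : ∀ i ∈ s, w i ≠ ∞ := by
    intro i hi h
    have hle : w i ≤ ∑ j ∈ s, w j := Finset.single_le_sum (f := w) (fun j _ => zero_le) hi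
    rw [hw, h] at hle
    exact ENNReal.top_ne_one (le_antisymm hle le_top)
  have hw_toReal : ∑ i ∈ s, (w i).toReal = 1 := by
    rw [← ENNReal.toReal_sum hw_ne_top, hw, ENNReal.toReal_one]
  -- the mixture is a probability measure
  haveI : IsProbabilityMeasure (∑ i ∈ s, w i • μ i) := by
    refine ⟨?_⟩
    simp only [Measure.coe_finsetSum, Measure.coe_smul, Finset.sum_apply, Pi.smul_apply,
      measure_univ, smul_eq_mul, mul_one, hw]
  -- Donsker–Varadhan with `K = ∑ w_i KL_i`
  set K : ℝ := ∑ i ∈ s, (w i).toReal * (klDiv (μ i) ν).toReal with hKdef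
  have hK : klDiv (∑ i ∈ s, w i • μ i) ν ≤ ENNReal.ofReal K := by
    refine klDiv_le_of_forall_integral_le fun ψ C hψ hCψ => ?_
    have hψi : ∀ i, Integrable ψ (μ i) := fun i =>
      Integrable.of_bound hψ.aestronglyMeasurable C (ae_of_all _ fun x => by
        rw [Real.norm_eq_abs]; exact hCψ x)
    rw [integral_finsetSum_measure fun i hi => (hψi i).smul_measure (hw_ne_top i hi)]
    simp only [integral_smul_measure, smul_eq_mul]
    have hterm : ∀ i ∈ s, (w i).toReal * ∫ x, ψ x ∂μ i ≤
        (w i).toReal * ((klDiv (μ i) ν).toReal + Real.log (∫ x, Real.exp (ψ x) ∂ν)) := by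
      intro i hi
      by_cases hwi : w i = 0
      · simp [hwi]
      · exact mul_le_mul_of_nonneg_left
          (integral_le_toReal_klDiv_add_log (hdeg i hi hwi) hψ hCψ) ENNReal.toReal_nonneg
    calc ∑ i ∈ s, (w i).toReal * ∫ x, ψ x ∂μ i
        ≤ ∑ i ∈ s, (w i).toReal * ((klDiv (μ i) ν).toReal + Real.log (∫ x, Real.exp (ψ x) ∂ν)) :=
          Finset.sum_le_sum hterm
      _ = K + (∑ i ∈ s, (w i).toReal) * Real.log (∫ x, Real.exp (ψ x) ∂ν) := by
          rw [hKdef, Finset.sum_mul, ← Finset.sum_add_distrib]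
          refine Finset.sum_congr rfl fun i _ => ?_
          ring
      _ = K + Real.log (∫ x, Real.exp (ψ x) ∂ν) := by rw [hw_toReal, one_mul]
  -- `ofReal K ≤ ∑ w_i KL_i`
  refine hK.trans ?_
  rw [hKdef, ENNReal.ofReal_sum_of_nonneg fun i _ => mul_nonneg ENNReal.toReal_nonneg ENNReal.toReal_nonneg]
  refine Finset.sum_le_sum fun i _ => ?_
  rw [ENNReal.ofReal_mul ENNReal.toReal_nonneg]
  exact mul_le_mul' ENNReal.ofReal_toReal_le ENNReal.ofReal_toReal_le

/-- **Cesàro means**: `KL(|s|⁻¹ ∑_{i∈s} μ_i ‖ ν) ≤ |s|⁻¹ ∑_{i∈s} KL(μ_i ‖ ν)` for a nonempty finite family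
of probability measures (the equal-weights case of `klDiv_sum_smul_le`; the form in which regularity
constants of states survive space averaging). [cite: KipnisLandim1999, Appendix 1 §8 (entropy is convex)] -/
theorem klDiv_cesaro_le {ι : Type*} (s : Finset ι) (hs : s.Nonempty) (μ : ι → Measure α)
    [∀ i, IsProbabilityMeasure (μ i)] (ν : Measure α) [IsProbabilityMeasure ν] :
    klDiv ((s.card : ℝ≥0∞)⁻¹ • ∑ i ∈ s, μ i) ν ≤ (s.card : ℝ≥0∞)⁻¹ * ∑ i ∈ s, klDiv (μ i) ν := by
  have hcard0 : (s.card : ℝ≥0∞) ≠ 0 := by exact_mod_cast hs.card_pos.ne'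
  have hcardt : (s.card : ℝ≥0∞) ≠ ∞ := ENNReal.natCast_ne_top _
  have hw : ∑ _i ∈ s, (s.card : ℝ≥0∞)⁻¹ = 1 := by
    rw [Finset.sum_const, nsmul_eq_mul, ENNReal.mul_inv_cancel hcard0 hcardt]
  have h := klDiv_sum_smul_le s (fun _ => (s.card : ℝ≥0∞)⁻¹) hw μ ν
  rw [← Finset.smul_sum, ← Finset.mul_sum] at h
  exact h

end Literature.Probability.Divergences

end
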